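import Literature.MathematicalPhysics.QuantumFieldTheory.Balaban1983to89.B11Eq176Expansion

/-!
# `Balaban1983to89.B11Eq174Chart` — T. Bałaban, *The variational problem and background fields in renormalization group method for
lattice gauge theories*, Commun. Math. Phys. **102** (1985) 277–309 [Balaban1985Variational], Sect. G pp. 305–309, Proposition 9:
«The function 𝓗(B) is determined by Eqs. (174), (175), or (179), (180)» — THE LANDAU-GAUGE CHART 𝓗 AS A LEAN FUNCTION over the
tree's contraction scheme `B11Prop6Scheme` (abstract complex Banach spaces), with its printed properties PROVED there: determinedness
by (174)–(175), `𝓗(0) = 0`, the norm form of «𝓗 satisfies the conditions (19)–(21)», (177) «the expansion of 𝓗 begins with the first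
order term H₁B», and «It is an analytic function of B»

HONEST FRAMING (cell `lit-balaban`, verbatim): statement-level skeleton of published theorems with citation tags; proofs where landed; nothing here is a claim about the Yang–Mills mass gap.

PDF held: `paper:balaban1985-cmp102-variational-background` (journal page = PDF page + 276).  Renders
`pub-balaban/b2b-balaban-ref1/pages/1985-cmp102-variational-background/…-p029-x2.png` (p. 305: (170)–(175)) and `…-p030-x2.png` (p. 306:
(176)–(180)) READ AS IMAGES by this seat; Prop. 9 (p. 309) and pp. 307–308 from the render-verified transcript
`pub-balaban/b2b-balaban-b11/transcript.md`; [I] = T. Bałaban, CMP **109** (1987) [Balaban1987RG1] p. 275 (3.26)–(3.27) from its render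
`…/1987-cmp109-rg-I-small-field-p027-x2.png` (read as image).

WHY THIS FILE (interface).  `HOME/INTERFACES.md` §3 row «NE9 OWNER NEED-3(b)» (iface-1 v1.11/v1.11a, 2026-08-21T04:27Z/04:31Z): every
printed statement around the chart has its row and decls BY NAME (`B12QPrime348.lam330` = the (3.30) potential with the chart VALUE an
input; `B11Eq129Minimizer.hOp` = H₀/H₁; `B11.LGData.T47`/`Def47`, `B11Eq81Expansion.functional74`, `B11Prop6Scheme`, …); «the ONE
missing object is a DEFINITION — the minimiser's Landau-gauge chart … as an OBJECT … OPEN / NO TAKER».  This file types that object in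
the only vocabulary the tree has for Sects. D–G of the paper: the abstract scheme of `B11Prop6Scheme` (configurations `𝒴` with the norm of
(115), currents `𝒵`, `𝒢 = 𝔊` (or `G̃`), `Λ` = the optional linear term of (143)/(179), `W = (δ/δA′)V`, all DATA).  HONEST SCOPE: the tree
holds NO concrete lattice instances of the operators 𝔊, (δ/δA′)V, H₁, H, D of [5]/[15] (they are `…Printed` hypotheses over abstract
carriers), so the chart is an object over the abstract scheme, NOT over `B11Eq7Convention.concreteVarProblem`; the identification
«U_k(V′V₀)U_k(V₀)⁻¹ transformed to the Landau gauge is, by the definition, equal to exp iη𝓗(B)» (Prop. 9) and [I] (3.27)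
«U_{k+1}(□₀, V) = (exp iL⁻¹η𝐇_{k+1}(□₀, (1/i) log V))^{u_{k+1}}» relate 𝓗 to the minimiser, which the tree carries only abstractly
(`B11.Thm1Printed`, `Setup.IsBackground`) — recorded here as READINGS, not as theorems.

THE PRINT, verbatim.  p. 305: *«At first we fix the Landau gauge for the configuration U_k(V′V₀)U₀⁻¹ = U₁, and we have U₁ = exp iη𝓗(B),
𝓗 satisfies the conditions (19)–(21) with ε₂ = B₁(B₃(1 + 4C₁)ε₁ + C₁ε₁) ≤ 6B₁B₃C₁ε₁ = B₅ε₁. (173) … The configuration 𝓗 is represented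
as  𝓗 = 𝒜₁ + H₁B − HD(𝒜₁ + H₁B), (174)  where 𝒜₁ satisfies the equation  𝒜₁ + 𝔊((δ/δA′)V)(𝒜₁ + H₁B) = 0, (175)  and the regularity
conditions (19) with ε₂ = 8B₅ε₁. The function on the right-hand side of (174) is an analytic function of 𝒜₁ + H₁B, and we have discussed
its expansion in Sect. C.»*  p. 306: *«The function 𝒜₁, as a solution of Eq. (175), is an analytic function of H₁B, hence of B. … Let us
notice that it begins with a term of second order in H₁B, more exactly we have 𝒜₁^{(2)} = −𝔊((δ/δA′)V^{(3)})(H₁B). (176) This implies that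
the expansion of 𝓗 begins with the first order term H₁B. … 𝓗 = 𝒜₀ + H₀B − HD(𝒜₀ + H₀B), (179) where 𝒜₀ satisfies the equation obtained
from (143), 𝒜₀ − G̃Δ^{(2)}(𝒜₀ + H₀B) + G̃((δ/δA′)V)(𝒜₀ + H₀B) = 0. … (180) It is an equation of the same type as (175), and it has the same
analyticity properties»*.  p. 309, PROPOSITION 9: *«… The function U_k(V′V₀)U_k(V₀)⁻¹ transformed to the Landau gauge is, by the
definition, equal to exp iη𝓗(B), where B = (1/i) log V′. The function 𝓗(B) is determined by Eqs. (174), (175), or (179), (180). It is an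
analytic function of B … It satisfies the conditions (19)–(21) with ε₂ = B₅ε₁ (see (173))»*.  Prop. 6 p. 295: *«Eq. (111) has exactly one
solution in the space (115). … if we replace the configuration H₁B by an arbitrary configuration 𝔄 … then the above statement is again
true and the solution is an analytic function of 𝔄.»*  [I] p. 275 (3.27): *«We make the next gauge transformation u_{k+1} changing the axial
gauge into Landau gauge for the configuration U_{k+1}(□₀, V), hence U_{k+1}(□₀, V) = (exp iL⁻¹η𝐇_{k+1}(□₀, (1/i) log V))^{u_{k+1}},
|𝐇_{k+1}(□₀, (1/i) log V)|, |∇^{L⁻¹η}𝐇_{k+1}(□₀, (1/i) log V)|, ‖𝐇_{k+1}(□₀, (1/i) log V)‖_{1,β} < B₃O(1)Mα₀ on □̃⁴ …»* — the same chart for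
the (k+1)-st problem on □₀ at V₀ = 1.

WHAT IS DEFINED AND PROVED (Mathlib + `B11Prop6Scheme`, `B11Eq176Expansion`, `B11.ineq118_121` BY NAME; nothing re-proved).
* `solA 𝒢 Λ W J ε₄ 𝔄` — THE SOLUTION OPERATOR of (175)/(116)/(143)/(180): a solution `X` of `X = mapT 𝒢 Λ W J 𝔄 X` (= `−𝒢J + Λ(X + 𝔄) −
  𝒢(W(X + 𝔄))`) with `‖X‖ ≤ ε₄`, selected by `Classical.epsilon` (junk when none exists).  `Regime 𝒢 Λ W B₀ θ C₄ a₃ j a ε₄` bundles the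
  hypotheses of the scheme ((117)–(121), θ-extended, exactly those of `B11Prop6Scheme.existsUnique_solution`); `Regime.ofProp6` builds it
  from Proposition 6's PRINTED smallness conditions (`B11.ineq118_121`).  Under a regime: `solA` is THE unique solution in the ball
  (`Regime.solA_mem`, `Regime.eq_solA`), satisfies (175) literally for `Λ = 0, J = 0` (`Regime.eq175`), does not depend on the auxiliary
  radius (`Regime.solA_eq_of_le`), vanishes at `𝔄 = 0, J = 0` (`Regime.solA_zero`), is of second order `‖𝒜₁‖ ≤ B₀C₄(ε₄ + a)²`
  (`Regime.norm_solA_le_sq`, from `B11Eq176Expansion`), and depends holomorphically on holomorphic data (`Regime.solA_differentiableOn`,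
  from `B11Prop6Scheme.solution_analytic`).
* `chartH 𝒢 Λ W J T ε₄ 𝔄 := T (solA … 𝔄 + 𝔄)` — **(174)/(179)/(112)**, with `T` = the Landau-gauge map (47) `A′ ↦ A′ − HD(A′)` as a DATUM
  (print: «an analytic function of 𝒜₁ + H₁B», Sect. C); `chartHB … H₁ B := chartH … (H₁ B)` — 𝓗 as a function of `B` ((174): `𝔄 = H₁B`;
  (179): `𝔄 = H₀B`).  PROVED: `Regime.chartH_eq174` (𝓗 = T(𝒜₁ + 𝔄) with 𝒜₁ the unique solution of (175) in the ball — «determined by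
  Eqs. (174), (175)»), `Regime.chartH_eq_of_solution` (any solution in the ball gives the same value), `Regime.chartH_zero` (B = 0 ⇒ 𝓗 = 0
  when `T 0 = 0`: U_k(V₀)U_k(V₀)⁻¹ = 1), `Regime.norm_chartH_le` (‖𝓗‖ ≤ K(‖𝒜₁‖ + ‖𝔄‖) ≤ K(ε₄ + ‖𝔄‖) for `T` K-Lipschitz on the ball with
  `T 0 = 0` — the norm form of «satisfies (19)–(21) with ε₂ = B₅ε₁» and of [I] (3.27)), `Regime.norm_chartH_sub_le` /
  `Regime.norm_chartH_sub_self_le` (**(177)**: ‖𝓗 − T𝔄‖ ≤ K·B₀C₄(ε₄ + a)², and ‖𝓗 − 𝔄‖ ≤ (K_D + K·B₀C₄)(ε₄ + a)² when `HD` is of second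
  order — «the expansion of 𝓗 begins with the first order term H₁B»), `Regime.chartH_differentiableOn` / `Regime.chartHB_differentiableOn_line`
  (**«It is an analytic function of B»**: holomorphic along holomorphic families / complex lines `P + σQ`, for `T` holomorphic on the ball).
No `Prop` placeholder and no new fact: two definitions with bodies, one hypothesis structure, proved lemmas; axioms standard.  Unit
`lit-balaban-p07` (Phase-2 seat p07 gen 4, spare budget; TAKING line HOME/STATUS.md 2026-08-21T04:51:44Z), HOME `run/shared/lean/pub/lit-balaban/`.
-/

noncomputable section

namespace Literature.MathematicalPhysics.QuantumFieldTheory.Balaban1983to89.B11Eq174Chart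

open Metric Set
open Literature.MathematicalPhysics.QuantumFieldTheory.Balaban1983to89
open Literature.MathematicalPhysics.QuantumFieldTheory.Balaban1983to89.B13Contraction113 (QuadAnalytic)
open Literature.MathematicalPhysics.QuantumFieldTheory.Balaban1983to89.B11Prop6Scheme
open Literature.MathematicalPhysics.QuantumFieldTheory.Balaban1983to89.B11Eq176Expansion

variable {𝒴 𝒵 : Type*} [NormedAddCommGroup 𝒴] [NormedSpace ℂ 𝒴] [NormedAddCommGroup 𝒵] [NormedSpace ℂ 𝒵]

/-! ## §1 The solution operator of (175) / (116) / (143) / (180) -/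

/-- **The solution 𝒜(𝔄) of (175)** (and of (116), (143), (180): `X = −𝒢J + Λ(X + 𝔄) − 𝒢(W(X + 𝔄))`) in the ball `‖X‖ ≤ ε₄` of (115), AS A
FUNCTION of the datum `𝔄` (= `H₁B`, `H₀B`, or Prop. 6's «arbitrary configuration 𝔄»): a solution selected by `Classical.epsilon` — the
unique one whenever the scheme's conditions hold (`Regime.eq_solA`), an unspecified element of `𝒴` otherwise.
[cite: Balaban1985Variational, (175) p.305, Prop. 6 p.295] -/
def solA (𝒢 : 𝒵 →L[ℂ] 𝒴) (Λ : 𝒴 →L[ℂ] 𝒴) (W : 𝒴 → 𝒵) (J : 𝒵) (ε₄ : ℝ) (𝔄 : 𝒴) : 𝒴 :=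
  Classical.epsilon fun X : 𝒴 => ‖X‖ ≤ ε₄ ∧ mapT 𝒢 Λ W J 𝔄 X = X

variable {𝒢 : 𝒵 →L[ℂ] 𝒴} {Λ : 𝒴 →L[ℂ] 𝒴} {W : 𝒴 → 𝒵} {J : 𝒵} {ε₄ : ℝ} {𝔄 : 𝒴}

/-- If (175) has a solution in the ball, `solA` is one. [cite: Balaban1985Variational, (175) p.305] -/
theorem solA_spec (h : ∃ X : 𝒴, ‖X‖ ≤ ε₄ ∧ mapT 𝒢 Λ W J 𝔄 X = X) :
    ‖solA 𝒢 Λ W J ε₄ 𝔄‖ ≤ ε₄ ∧ mapT 𝒢 Λ W J 𝔄 (solA 𝒢 Λ W J ε₄ 𝔄) = solA 𝒢 Λ W J ε₄ 𝔄 :=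
  Classical.epsilon_spec h

/-- If (175) has EXACTLY ONE solution in the ball (Prop. 6), every solution in the ball is `solA`.
[cite: Balaban1985Variational, Prop. 6 p.295] -/
theorem eq_solA_of_existsUnique (h : ∃! X : 𝒴, ‖X‖ ≤ ε₄ ∧ mapT 𝒢 Λ W J 𝔄 X = X) {X : 𝒴} (hX : ‖X‖ ≤ ε₄)
    (hfix : mapT 𝒢 Λ W J 𝔄 X = X) : X = solA 𝒢 Λ W J ε₄ 𝔄 :=
  h.unique ⟨hX, hfix⟩ (solA_spec h.exists)

/-- (175)/(158) as an equation: `X` is a fixed point of `mapT 𝒢 0 W 0 𝔄` iff `X + 𝒢(W(X + 𝔄)) = 0`.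
[cite: Balaban1985Variational, (175) p.305, (158) p.302] -/
theorem fixed_iff_eq175 (X : 𝒴) : mapT 𝒢 0 W 0 𝔄 X = X ↔ X + 𝒢 (W (X + 𝔄)) = 0 := by
  rw [mapT_158, eq_comm, eq_neg_iff_add_eq_zero]

/-- **The hypotheses of the contraction scheme**, bundled — exactly those of `B11Prop6Scheme.existsUnique_solution` ((117)–(121) with the
optional linear term of norm `θ`): `‖𝒢f‖ ≤ B₀‖f‖` (Thm 3.13 [5]), `‖ΛY‖ ≤ θ‖Y‖`, `W = (δ/δA′)V` quadratic-analytic (Prop. 4), the data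
bounds `‖J‖ ≤ j`, `‖𝔄‖ < a` enter the theorems; the domain condition `2(ε₄ + a) ≤ a₃` ((121) first member), the self-map condition (118)
and the contraction condition ((121) second member).  A hypothesis structure: nothing printed is asserted.
[cite: Balaban1985Variational, (117)–(121) p.295] -/
structure Regime (𝒢 : 𝒵 →L[ℂ] 𝒴) (Λ : 𝒴 →L[ℂ] 𝒴) (W : 𝒴 → 𝒵) (B₀ θ C₄ a₃ j a ε₄ : ℝ) : Prop where
  norm_G : ∀ f, ‖𝒢 f‖ ≤ B₀ * ‖f‖
  norm_L : ∀ Y, ‖Λ Y‖ ≤ θ * ‖Y‖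
  quad : QuadAnalytic W C₄ a₃
  B₀_nonneg : 0 ≤ B₀
  C₄_nonneg : 0 ≤ C₄
  θ_nonneg : 0 ≤ θ
  ε₄_nonneg : 0 ≤ ε₄
  dom : 2 * (ε₄ + a) ≤ a₃
  self : B₀ * j + θ * (ε₄ + a) + B₀ * C₄ * (ε₄ + a) ^ 2 ≤ ε₄
  contr : θ + 4 * B₀ * C₄ * (ε₄ + a) < 1

/-- **Proposition 6's printed hypotheses give a regime** (θ = 0, no linear term, as in (116)/(175)): under «ε₄ ≤ a₄ and ε₁ satisfying
2B₀C₁B₃ε₁ ≤ ε₄» (a₄ unfolded as `4ε₄ ≤ a₃ ∧ 16B₀C₄ε₄ ≤ 1`, and `dL ≤ B₃`), with `j = C₁B₃ε₁` (the bound `|J|_{(−3)} < C₁B₃ε₁`) and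
`a = 2dL·B₀C₁ε₁` (the bound `|H₁B| ≤ B₀|B|`, `|B| < 2dLC₁ε₁`), the conditions (118), (121) hold (`B11.ineq118_121`).
[cite: Balaban1985Variational, Prop. 6 (118)–(121) p.295] -/
theorem Regime.ofProp6 {B₀ C₄ a₃ : ℝ} (h𝒢 : ∀ f, ‖𝒢 f‖ ≤ B₀ * ‖f‖) (hW : QuadAnalytic W C₄ a₃)
    (hB₀ : 0 ≤ B₀) (hC₄ : 0 ≤ C₄) {dL C₁ B₃ ε₁ ε₄ : ℝ} (hdL : 0 ≤ dL) (hC₁ : 0 ≤ C₁) (hε₁ : 0 ≤ ε₁) (hε₄ : 0 ≤ ε₄) (hB₃ : dL ≤ B₃)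
    (h1 : 2 * B₀ * C₁ * B₃ * ε₁ ≤ ε₄) (h2 : 4 * ε₄ ≤ a₃) (h3 : 16 * B₀ * C₄ * ε₄ ≤ 1) :
    Regime 𝒢 0 W B₀ 0 C₄ a₃ (C₁ * B₃ * ε₁) (2 * dL * B₀ * C₁ * ε₁) ε₄ := by
  obtain ⟨⟨-, h118⟩, ⟨h121a, h121b⟩⟩ := B11.ineq118_121 dL B₀ C₁ C₄ B₃ a₃ ε₁ ε₄ hdL hB₀ hC₁ hC₄ hε₁ hε₄ hB₃ h1 h2 h3
  refine ⟨h𝒢, fun Y => by simp, hW, hB₀, hC₄, le_rfl, hε₄, by linarith, ?_, by linarith⟩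
  have : B₀ * (C₁ * B₃ * ε₁) = B₀ * C₁ * B₃ * ε₁ := by ring
  rw [this, zero_mul, add_zero]; exact h118

namespace Regime

variable {B₀ θ C₄ a₃ j a : ℝ}

/-- **Prop. 6: exactly one solution in the ball.** [cite: Balaban1985Variational, Prop. 6 p.295] -/
theorem existsUnique [CompleteSpace 𝒴] (R : Regime 𝒢 Λ W B₀ θ C₄ a₃ j a ε₄) (hJ : ‖J‖ ≤ j) (h𝔄 : ‖𝔄‖ < a) :
    ∃! X : 𝒴, ‖X‖ ≤ ε₄ ∧ mapT 𝒢 Λ W J 𝔄 X = X :=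
  existsUnique_solution R.norm_G R.norm_L R.quad R.B₀_nonneg R.C₄_nonneg R.θ_nonneg hJ h𝔄 R.ε₄_nonneg R.dom
    R.self R.contr

/-- `solA` lies in the ball (115) and solves the equation. [cite: Balaban1985Variational, Prop. 6 p.295, (175) p.305] -/
theorem solA_mem [CompleteSpace 𝒴] (R : Regime 𝒢 Λ W B₀ θ C₄ a₃ j a ε₄) (hJ : ‖J‖ ≤ j) (h𝔄 : ‖𝔄‖ < a) :
    ‖solA 𝒢 Λ W J ε₄ 𝔄‖ ≤ ε₄ ∧ mapT 𝒢 Λ W J 𝔄 (solA 𝒢 Λ W J ε₄ 𝔄) = solA 𝒢 Λ W J ε₄ 𝔄 :=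
  solA_spec (R.existsUnique hJ h𝔄).exists

/-- Uniqueness: a solution in the ball IS `solA`. [cite: Balaban1985Variational, Prop. 6 p.295] -/
theorem eq_solA [CompleteSpace 𝒴] (R : Regime 𝒢 Λ W B₀ θ C₄ a₃ j a ε₄) (hJ : ‖J‖ ≤ j) (h𝔄 : ‖𝔄‖ < a) {X : 𝒴}
    (hX : ‖X‖ ≤ ε₄) (hfix : mapT 𝒢 Λ W J 𝔄 X = X) : X = solA 𝒢 Λ W J ε₄ 𝔄 :=
  eq_solA_of_existsUnique (R.existsUnique hJ h𝔄) hX hfix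

/-- The general equation solved: `𝒜 = −𝒢J + Λ(𝒜 + 𝔄) − 𝒢(W(𝒜 + 𝔄))` ((116) with the linear term of (143); the display before (180)).
[cite: Balaban1985Variational, (116) p.295, (143) p.300, (180) p.306] -/
theorem solA_eq [CompleteSpace 𝒴] (R : Regime 𝒢 Λ W B₀ θ C₄ a₃ j a ε₄) (hJ : ‖J‖ ≤ j) (h𝔄 : ‖𝔄‖ < a) :
    solA 𝒢 Λ W J ε₄ 𝔄 = -𝒢 J + Λ (solA 𝒢 Λ W J ε₄ 𝔄 + 𝔄) - 𝒢 (W (solA 𝒢 Λ W J ε₄ 𝔄 + 𝔄)) :=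
  ((R.solA_mem hJ h𝔄).2).symm

/-- **(175) literally**: `𝒜₁ + 𝔊((δ/δA′)V)(𝒜₁ + H₁B) = 0` for the selected solution (`Λ = 0`, `J = 0`; `0 ≤ j`).
[cite: Balaban1985Variational, (175) p.305] -/
theorem eq175 [CompleteSpace 𝒴] (R : Regime 𝒢 0 W B₀ θ C₄ a₃ j a ε₄) (hj : 0 ≤ j) (h𝔄 : ‖𝔄‖ < a) :
    solA 𝒢 0 W 0 ε₄ 𝔄 + 𝒢 (W (solA 𝒢 0 W 0 ε₄ 𝔄 + 𝔄)) = 0 :=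
  (fixed_iff_eq175 _).1 (R.solA_mem (J := 0) (by simpa using hj) h𝔄).2

/-- The auxiliary radius is immaterial: two admissible radii `ε₄′ ≤ ε₄` select the same solution (existence in the smaller ball, uniqueness
in the larger — the nested-balls argument of «This solution satisfies the bounds (115) with ε₄ = 3B₀C₁B₃ε₁»).
[cite: Balaban1985Variational, Prop. 6 p.295] -/
theorem solA_eq_of_le [CompleteSpace 𝒴] {ε₄' : ℝ} (R : Regime 𝒢 Λ W B₀ θ C₄ a₃ j a ε₄)
    (R' : Regime 𝒢 Λ W B₀ θ C₄ a₃ j a ε₄') (hle : ε₄' ≤ ε₄) (hJ : ‖J‖ ≤ j) (h𝔄 : ‖𝔄‖ < a) :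
    solA 𝒢 Λ W J ε₄' 𝔄 = solA 𝒢 Λ W J ε₄ 𝔄 :=
  R.eq_solA hJ h𝔄 ((R'.solA_mem hJ h𝔄).1.trans hle) (R'.solA_mem hJ h𝔄).2

/-- `W 0 = 0` ((δ/δA′)V is at least quadratic, (98)). [cite: Balaban1985Variational, (98) p.293] -/
theorem map_zero (R : Regime 𝒢 Λ W B₀ θ C₄ a₃ j a ε₄) (ha : 0 < a) : W 0 = 0 := by
  have ha₃ : ‖(0 : 𝒴)‖ < a₃ := by
    rw [norm_zero]; linarith [R.dom, R.ε₄_nonneg]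
  have h := R.quad.quad 0 ha₃
  rw [norm_zero] at h
  exact norm_le_zero_iff.1 (h.trans (by simp))

/-- **B = 0 ⇒ 𝒜 = 0** (`J = 0`): `0` solves (175) at `𝔄 = 0`, hence is the selected solution (U_k(V₀)U_k(V₀)⁻¹ = 1 in Prop. 9's setting).
[cite: Balaban1985Variational, (175) p.305, Prop. 9 p.309] -/
theorem solA_zero [CompleteSpace 𝒴] (R : Regime 𝒢 Λ W B₀ θ C₄ a₃ j a ε₄) (hj : 0 ≤ j) (ha : 0 < a) :
    solA 𝒢 Λ W 0 ε₄ (0 : 𝒴) = 0 := by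
  symm
  refine R.eq_solA (J := 0) (by simpa using hj) (by simpa using ha) (by simpa using R.ε₄_nonneg) ?_
  simp [mapT, R.map_zero ha]

/-- **Second order** (p. 306 «it begins with a term of second order in H₁B»; `B11Eq176Expansion.norm_solution_le_sq`): for `Λ = 0, J = 0`,
`‖𝒜₁(𝔄)‖ ≤ B₀C₄(ε₄ + a)²`. [cite: Balaban1985Variational, (176) p.306] -/
theorem norm_solA_le_sq [CompleteSpace 𝒴] (R : Regime 𝒢 0 W B₀ θ C₄ a₃ j a ε₄) (hj : 0 ≤ j) (h𝔄 : ‖𝔄‖ < a) :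
    ‖solA 𝒢 0 W 0 ε₄ 𝔄‖ ≤ B₀ * C₄ * (ε₄ + a) ^ 2 := by
  have hm := R.solA_mem (J := 0) (by simpa using hj) h𝔄
  have ha : 0 < a := (norm_nonneg _).trans_lt h𝔄
  have hdom : ε₄ + a ≤ a₃ := by linarith [R.dom, R.ε₄_nonneg]
  exact norm_solution_le_sq R.norm_G R.quad R.B₀_nonneg R.C₄_nonneg h𝔄 hdom hm.1 hm.2

/-- **«the solution is an analytic function of 𝔄»** (Prop. 6 p. 296; `B11Prop6Scheme.solution_analytic`): for holomorphic families
`σ ↦ J_σ`, `σ ↦ 𝔄_σ` on an open `V ⊆ ℂ` inside the regime, `σ ↦ 𝒜(𝔄_σ)` (the selected solution) is holomorphic on `V` — by uniqueness it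
IS the holomorphic solution family. [cite: Balaban1985Variational, Prop. 6 pp.295–296, (180) p.306] -/
theorem solA_differentiableOn [CompleteSpace 𝒴] (R : Regime 𝒢 Λ W B₀ θ C₄ a₃ j a ε₄) (hW : Prop4Hyp W C₄ a₃)
    {V : Set ℂ} (hV : IsOpen V) {Jf : ℂ → 𝒵} {𝔄f : ℂ → 𝒴} (hJd : DifferentiableOn ℂ Jf V)
    (h𝔄d : DifferentiableOn ℂ 𝔄f V) (hJ : ∀ σ ∈ V, ‖Jf σ‖ ≤ j) (h𝔄 : ∀ σ ∈ V, ‖𝔄f σ‖ < a) :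
    DifferentiableOn ℂ (fun σ => solA 𝒢 Λ W (Jf σ) ε₄ (𝔄f σ)) V := by
  obtain ⟨Xs, hXd, hXs⟩ := solution_analytic R.norm_G R.norm_L hW R.B₀_nonneg R.C₄_nonneg R.θ_nonneg R.ε₄_nonneg
    R.dom R.self R.contr hV hJd h𝔄d hJ h𝔄
  refine hXd.congr fun σ hσ => ?_
  obtain ⟨-, -, huniq⟩ := hXs σ hσ
  have hm := R.solA_mem (hJ σ hσ) (h𝔄 σ hσ)
  exact huniq _ hm.1 hm.2

end Regime

/-! ## §2 The chart (174) / (179) -/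

/-- **(174)/(179) — the Landau-gauge chart 𝓗** as a function of the datum `𝔄` (= `H₁B` in (174), `H₀B` in (179), Prop. 6's «arbitrary
configuration 𝔄» in (112)): `𝓗 = T(𝒜 + 𝔄)` with `𝒜 = solA … 𝔄` the solution of (175) and `T` = the map (47) `A′ ↦ A′ − HD(A′)` of Sect. C
(«an analytic function of 𝒜₁ + H₁B»), a DATUM.  In Prop. 9's words exp iη𝓗(B) is U_k(V′V₀)U_k(V₀)⁻¹ transformed to the Landau gauge,
B = (1/i) log V′; in [I] (3.27) the same chart for the (k+1)-st problem on □₀ at V₀ = 1 is 𝐇_{k+1}(□₀, B).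
[cite: Balaban1985Variational, (174) p.305, (179) p.306, Prop. 9 p.309] -/
def chartH (𝒢 : 𝒵 →L[ℂ] 𝒴) (Λ : 𝒴 →L[ℂ] 𝒴) (W : 𝒴 → 𝒵) (J : 𝒵) (T : 𝒴 → 𝒴) (ε₄ : ℝ) (𝔄 : 𝒴) : 𝒴 :=
  T (solA 𝒢 Λ W J ε₄ 𝔄 + 𝔄)

/-- **𝓗 as a function of B** («It is an analytic function of B»): `𝔄 = H₁B` ((174)) or `H₀B` ((179)), `H₁`/`H₀` the linear minimisers
((103)/(129); abstractly `B11Eq129Minimizer.hOp`) as a continuous linear DATUM. [cite: Balaban1985Variational, (174) p.305, Prop. 9 p.309] -/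
abbrev chartHB (𝒢 : 𝒵 →L[ℂ] 𝒴) (Λ : 𝒴 →L[ℂ] 𝒴) (W : 𝒴 → 𝒵) (J : 𝒵) (T : 𝒴 → 𝒴) (ε₄ : ℝ) {𝒳 : Type*}
    [NormedAddCommGroup 𝒳] [NormedSpace ℂ 𝒳] (H₁ : 𝒳 →L[ℂ] 𝒴) (B : 𝒳) : 𝒴 :=
  chartH 𝒢 Λ W J T ε₄ (H₁ B)

/-- Unfolding. [cite: Balaban1985Variational, (174) p.305] -/
theorem chartH_def (T : 𝒴 → 𝒴) : chartH 𝒢 Λ W J T ε₄ 𝔄 = T (solA 𝒢 Λ W J ε₄ 𝔄 + 𝔄) := rfl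

namespace Regime

variable {B₀ θ C₄ a₃ j a : ℝ} {T : 𝒴 → 𝒴}

/-- **«The function 𝓗(B) is determined by Eqs. (174), (175)»**: there is exactly one `𝒜₁` in the ball (115) solving (175), and
`𝓗 = T(𝒜₁ + 𝔄)` (`Λ = 0`, `J = 0`). [cite: Balaban1985Variational, (174)–(175) p.305, Prop. 9 p.309] -/
theorem chartH_eq174 [CompleteSpace 𝒴] (R : Regime 𝒢 0 W B₀ θ C₄ a₃ j a ε₄) (hj : 0 ≤ j) (h𝔄 : ‖𝔄‖ < a) :
    ∃ 𝒜₁ : 𝒴, ‖𝒜₁‖ ≤ ε₄ ∧ 𝒜₁ + 𝒢 (W (𝒜₁ + 𝔄)) = 0 ∧ chartH 𝒢 0 W 0 T ε₄ 𝔄 = T (𝒜₁ + 𝔄) ∧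
      ∀ 𝒜' : 𝒴, ‖𝒜'‖ ≤ ε₄ → 𝒜' + 𝒢 (W (𝒜' + 𝔄)) = 0 → 𝒜' = 𝒜₁ :=
  ⟨solA 𝒢 0 W 0 ε₄ 𝔄, (R.solA_mem (J := 0) (by simpa using hj) h𝔄).1, R.eq175 hj h𝔄, rfl,
    fun 𝒜' h𝒜' hsol => R.eq_solA (J := 0) (by simpa using hj) h𝔄 h𝒜' ((fixed_iff_eq175 𝒜').2 hsol)⟩

/-- Determinedness, general form: ANY solution `𝒜'` of the equation in the ball gives the value of the chart, `𝓗 = T(𝒜' + 𝔄)`.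
[cite: Balaban1985Variational, (174) p.305, (179)–(180) p.306] -/
theorem chartH_eq_of_solution [CompleteSpace 𝒴] (R : Regime 𝒢 Λ W B₀ θ C₄ a₃ j a ε₄) (hJ : ‖J‖ ≤ j) (h𝔄 : ‖𝔄‖ < a)
    {𝒜' : 𝒴} (h𝒜' : ‖𝒜'‖ ≤ ε₄) (hfix : mapT 𝒢 Λ W J 𝔄 𝒜' = 𝒜') : chartH 𝒢 Λ W J T ε₄ 𝔄 = T (𝒜' + 𝔄) := by
  rw [chartH_def, ← R.eq_solA hJ h𝔄 h𝒜' hfix]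

/-- The chart does not depend on the auxiliary radius. [cite: Balaban1985Variational, Prop. 6 p.295] -/
theorem chartH_eq_of_le [CompleteSpace 𝒴] {ε₄' : ℝ} (R : Regime 𝒢 Λ W B₀ θ C₄ a₃ j a ε₄)
    (R' : Regime 𝒢 Λ W B₀ θ C₄ a₃ j a ε₄') (hle : ε₄' ≤ ε₄) (hJ : ‖J‖ ≤ j) (h𝔄 : ‖𝔄‖ < a) :
    chartH 𝒢 Λ W J T ε₄' 𝔄 = chartH 𝒢 Λ W J T ε₄ 𝔄 := by
  rw [chartH_def, chartH_def, R.solA_eq_of_le R' hle hJ h𝔄]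

/-- **B = 0 ⇒ 𝓗 = 0** (`J = 0`, `T 0 = 0`): Prop. 9's U_k(V′V₀)U_k(V₀)⁻¹ at V′ = 1 is 1 = exp iη·0.
[cite: Balaban1985Variational, Prop. 9 p.309] -/
theorem chartH_zero [CompleteSpace 𝒴] (R : Regime 𝒢 Λ W B₀ θ C₄ a₃ j a ε₄) (hj : 0 ≤ j) (ha : 0 < a) (hT0 : T 0 = 0) :
    chartH 𝒢 Λ W 0 T ε₄ (0 : 𝒴) = 0 := by
  rw [chartH_def, R.solA_zero hj ha, add_zero, hT0]

/-- **The norm form of «𝓗 satisfies the conditions (19)–(21)»** (and of [I] (3.27) `|𝐇_{k+1}(□₀,(1/i)log V)|, |∇…| < B₃O(1)Mα₀`, the norm of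
`𝒴` being the max-norm of (115)): for `T` `K`-Lipschitz on the ball of radius `ε₄ + a` with `T 0 = 0`,
`‖𝓗‖ ≤ K(‖𝒜‖ + ‖𝔄‖) ≤ K(ε₄ + ‖𝔄‖)`. [cite: Balaban1985Variational, (173) p.305, Prop. 9 p.309; Balaban1987RG1, (3.27) p.275] -/
theorem norm_chartH_le [CompleteSpace 𝒴] (R : Regime 𝒢 Λ W B₀ θ C₄ a₃ j a ε₄) (hJ : ‖J‖ ≤ j) (h𝔄 : ‖𝔄‖ < a) {K : ℝ}
    (hK : 0 ≤ K) (hT0 : T 0 = 0) (hT : ∀ x y : 𝒴, ‖x‖ < ε₄ + a → ‖y‖ < ε₄ + a → ‖T x - T y‖ ≤ K * ‖x - y‖) :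
    ‖chartH 𝒢 Λ W J T ε₄ 𝔄‖ ≤ K * (‖solA 𝒢 Λ W J ε₄ 𝔄‖ + ‖𝔄‖) ∧ ‖chartH 𝒢 Λ W J T ε₄ 𝔄‖ ≤ K * (ε₄ + ‖𝔄‖) := by
  have hm := R.solA_mem hJ h𝔄
  have ha : 0 < a := (norm_nonneg _).trans_lt h𝔄
  have harg : ‖solA 𝒢 Λ W J ε₄ 𝔄 + 𝔄‖ < ε₄ + a := norm_arg_lt h𝔄 hm.1
  have h0 : ‖(0 : 𝒴)‖ < ε₄ + a := by rw [norm_zero]; linarith [R.ε₄_nonneg]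
  have h1 : ‖chartH 𝒢 Λ W J T ε₄ 𝔄‖ ≤ K * ‖solA 𝒢 Λ W J ε₄ 𝔄 + 𝔄‖ := by
    have := hT _ _ harg h0
    rwa [hT0, sub_zero, sub_zero] at this
  have h2 : ‖solA 𝒢 Λ W J ε₄ 𝔄 + 𝔄‖ ≤ ‖solA 𝒢 Λ W J ε₄ 𝔄‖ + ‖𝔄‖ := norm_add_le _ _
  refine ⟨h1.trans (mul_le_mul_of_nonneg_left h2 hK), h1.trans (mul_le_mul_of_nonneg_left (h2.trans ?_) hK)⟩
  linarith [hm.1]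

/-- **(177), first member: «the expansion of 𝓗 begins with the first order term H₁B»** — the chart differs from `T𝔄` by the Lipschitz
constant of `T` times the second-order solution: `‖𝓗 − T𝔄‖ ≤ K‖𝒜₁‖ ≤ K·B₀C₄(ε₄ + a)²` (`Λ = 0`, `J = 0`).
[cite: Balaban1985Variational, (176)–(177) p.306] -/
theorem norm_chartH_sub_le [CompleteSpace 𝒴] (R : Regime 𝒢 0 W B₀ θ C₄ a₃ j a ε₄) (hj : 0 ≤ j) (h𝔄 : ‖𝔄‖ < a) {K : ℝ}
    (hK : 0 ≤ K) (hT : ∀ x y : 𝒴, ‖x‖ < ε₄ + a → ‖y‖ < ε₄ + a → ‖T x - T y‖ ≤ K * ‖x - y‖) :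
    ‖chartH 𝒢 0 W 0 T ε₄ 𝔄 - T 𝔄‖ ≤ K * ‖solA 𝒢 0 W 0 ε₄ 𝔄‖ ∧
      ‖chartH 𝒢 0 W 0 T ε₄ 𝔄 - T 𝔄‖ ≤ K * (B₀ * C₄ * (ε₄ + a) ^ 2) := by
  have hm := R.solA_mem (J := 0) (by simpa using hj) h𝔄
  have harg : ‖solA 𝒢 0 W 0 ε₄ 𝔄 + 𝔄‖ < ε₄ + a := norm_arg_lt h𝔄 hm.1
  have h𝔄' : ‖𝔄‖ < ε₄ + a := by linarith [R.ε₄_nonneg]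
  have h1 : ‖chartH 𝒢 0 W 0 T ε₄ 𝔄 - T 𝔄‖ ≤ K * ‖solA 𝒢 0 W 0 ε₄ 𝔄‖ := by
    have := hT _ _ harg h𝔄'
    rwa [add_sub_cancel_right] at this
  exact ⟨h1, h1.trans (mul_le_mul_of_nonneg_left (R.norm_solA_le_sq hj h𝔄) hK)⟩

/-- **(177): the first-order term is `𝔄 = H₁B` itself** when `HD` is of second order on the ball (`‖T Y − Y‖ ≤ K_D‖Y‖²`, `K_D ≥ 0`;
print: D^{(2)} = C^{(2)}, (56), the term «− HC^{(2)}(H₁B)» of (177)): `‖𝓗 − 𝔄‖ ≤ (K_D + B₀C₄)(ε₄ + a)²` (`Λ = 0`, `J = 0`).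
[cite: Balaban1985Variational, (177) p.306, (56) p.287] -/
theorem norm_chartH_sub_self_le [CompleteSpace 𝒴] (R : Regime 𝒢 0 W B₀ θ C₄ a₃ j a ε₄) (hj : 0 ≤ j) (h𝔄 : ‖𝔄‖ < a)
    {K_D : ℝ} (hKD : 0 ≤ K_D) (hTD : ∀ Y : 𝒴, ‖Y‖ < ε₄ + a → ‖T Y - Y‖ ≤ K_D * ‖Y‖ ^ 2) :
    ‖chartH 𝒢 0 W 0 T ε₄ 𝔄 - 𝔄‖ ≤ (K_D + B₀ * C₄) * (ε₄ + a) ^ 2 := by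
  have hm := R.solA_mem (J := 0) (by simpa using hj) h𝔄
  have harg : ‖solA 𝒢 0 W 0 ε₄ 𝔄 + 𝔄‖ < ε₄ + a := norm_arg_lt h𝔄 hm.1
  have hsq := R.norm_solA_le_sq hj h𝔄
  have e : chartH 𝒢 0 W 0 T ε₄ 𝔄 - 𝔄 =
      (T (solA 𝒢 0 W 0 ε₄ 𝔄 + 𝔄) - (solA 𝒢 0 W 0 ε₄ 𝔄 + 𝔄)) + solA 𝒢 0 W 0 ε₄ 𝔄 := by
    rw [chartH_def]; abel
  have h1 : ‖T (solA 𝒢 0 W 0 ε₄ 𝔄 + 𝔄) - (solA 𝒢 0 W 0 ε₄ 𝔄 + 𝔄)‖ ≤ K_D * (ε₄ + a) ^ 2 :=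
    (hTD _ harg).trans (mul_le_mul_of_nonneg_left (pow_le_pow_left₀ (norm_nonneg _) harg.le 2) hKD)
  rw [e]
  refine (norm_add_le _ _).trans ?_
  rw [add_mul]
  exact add_le_add h1 hsq

/-- **«It is an analytic function of B» / «the solution is an analytic function of 𝔄»** — for holomorphic data families `σ ↦ J_σ`,
`σ ↦ 𝔄_σ` on an open `V ⊆ ℂ` inside the regime and `T` holomorphic on the ball of radius `ε₄ + a` («The function on the right-hand side
of (174) is an analytic function of 𝒜₁ + H₁B»), `σ ↦ 𝓗(𝔄_σ)` is holomorphic on `V`. [cite: Balaban1985Variational, (174) p.305, Prop. 9 p.309] -/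
theorem chartH_differentiableOn [CompleteSpace 𝒴] (R : Regime 𝒢 Λ W B₀ θ C₄ a₃ j a ε₄) (hW : Prop4Hyp W C₄ a₃)
    {V : Set ℂ} (hV : IsOpen V) {Jf : ℂ → 𝒵} {𝔄f : ℂ → 𝒴} (hJd : DifferentiableOn ℂ Jf V)
    (h𝔄d : DifferentiableOn ℂ 𝔄f V) (hJ : ∀ σ ∈ V, ‖Jf σ‖ ≤ j) (h𝔄 : ∀ σ ∈ V, ‖𝔄f σ‖ < a)
    (hT : DifferentiableOn ℂ T (ball (0 : 𝒴) (ε₄ + a))) :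
    DifferentiableOn ℂ (fun σ => chartH 𝒢 Λ W (Jf σ) T ε₄ (𝔄f σ)) V := by
  have hsum : DifferentiableOn ℂ (fun σ => solA 𝒢 Λ W (Jf σ) ε₄ (𝔄f σ) + 𝔄f σ) V :=
    (R.solA_differentiableOn hW hV hJd h𝔄d hJ h𝔄).add h𝔄d
  refine hT.comp hsum fun σ hσ => ?_
  rw [mem_ball_zero_iff]
  exact norm_arg_lt (h𝔄 σ hσ) (R.solA_mem (hJ σ hσ) (h𝔄 σ hσ)).1

/-- **«It is an analytic function of B»** along complex lines: for `H₁ : 𝒳 →L[ℂ] 𝒴` and `P Q : 𝒳`, `σ ↦ 𝓗(H₁(P + σQ))` is holomorphic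
on the open set `{σ : ‖H₁(P + σQ)‖ < a}` (`J` fixed with `‖J‖ ≤ j`, `T` holomorphic on the ball).
[cite: Balaban1985Variational, Prop. 9 p.309, p.306] -/
theorem chartHB_differentiableOn_line [CompleteSpace 𝒴] (R : Regime 𝒢 Λ W B₀ θ C₄ a₃ j a ε₄) (hW : Prop4Hyp W C₄ a₃)
    (hJ : ‖J‖ ≤ j) (hT : DifferentiableOn ℂ T (ball (0 : 𝒴) (ε₄ + a))) {𝒳 : Type*} [NormedAddCommGroup 𝒳]
    [NormedSpace ℂ 𝒳] (H₁ : 𝒳 →L[ℂ] 𝒴) (P Q : 𝒳) :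
    DifferentiableOn ℂ (fun σ : ℂ => chartHB 𝒢 Λ W J T ε₄ H₁ (P + σ • Q)) {σ : ℂ | ‖H₁ (P + σ • Q)‖ < a} := by
  have hline : Differentiable ℂ (fun σ : ℂ => H₁ (P + σ • Q)) :=
    H₁.differentiable.comp ((differentiable_const P).add (differentiable_id.smul_const Q))
  have hV : IsOpen {σ : ℂ | ‖H₁ (P + σ • Q)‖ < a} := isOpen_lt hline.continuous.norm continuous_const
  exact R.chartH_differentiableOn hW hV (differentiableOn_const J) hline.differentiableOn (fun _ _ => hJ)
    (fun σ hσ => hσ) hT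

end Regime

end Literature.MathematicalPhysics.QuantumFieldTheory.Balaban1983to89.B11Eq174Chart
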